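import Mathlib.Computability.Encoding
import Mathlib.Data.Finset.Prod
import Mathlib.Data.Finset.Powerset
import Mathlib.Order.Lattice.Nat
import Mathlib.Algebra.BigOperators.Group.Finset.Basic
import Literature.Computability.Complexity.BoolEncodings
import Literature.Computability.Complexity.Reductions
import HarnessLib

/-!
# Discrete tomography: X-ray consistency problems on the triangular grid and in cones
# (Gardner–Gritzmann–Prangenberg 1999; Fischer–Ikenmeyer 2020, §5–§6)

Decision problems of discrete tomography that form the combinatorial half of the proof of
Fischer–Ikenmeyer's theorem "PLETHYSMPOSITIVITY is NP-hard" (Comput. Complexity 29 (2020),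
Thm. 1; barrier fact `Literature.Barriers.ValiantsHypothesis.FischerIkenmeyer2020_plethysmNPHard`),
vendored as the first layer of the decomposition of that fact (D-0014: named facts, proved
bottom-up). The chain of the printed proof (FI 2020, Fig. 2 and §6) is

  `2D-X-RAY` —L.8→ `(SKEW-)SYMMETRIC-2D-X-RAY` —L.5→ `PROMISE-(SKEW-)SYMMETRIC-3D-X-RAY`
  —L.4→ `(DUAL)PLETHYSMPOSITIVITY(3)` —L.1→ `(DUAL)PLETHYSMPOSITIVITY(m)`, `m ≥ 3`,

starting from the NP-hardness of `2D-X-RAY` (Gardner–Gritzmann–Prangenberg 1999, Thm. 3.7).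
This file holds the tomography notions and problems and the first three printed results as
named facts; the representation-theoretic steps (Lemmas 4 and 1, Thm. 4) and the assembly live in
`Literature/Barriers/ValiantsHypothesis/KroneckerPositivityHardnessProofs.lean`.

**Notions** (FI 2020, §5 and §6, pp. 9–11 of the held copy `arxiv-2002.00788`). Points are
`(x, y, z) ∈ ℕ³`; for a finite point set `P`, `X_i(P)`, `Y_i(P)`, `Z_i(P)` count the points with
`x = i`, `y = i`, `z = i` (`xMarginal`, `yMarginal`, `zMarginal`), and the *sum-marginal* is
`S_i(P) = Σ_{(x,y,z) ∈ P} (δ_{x,i} + δ_{y,i} + δ_{z,i})` (`sumMarginal = X + Y + Z`, eq. (7)). The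
*open cone* is `C = {x > y > z}`, the *closed cone* `C̄ = {x ≥ y ≥ z}` (`IsInOpenCone`,
`IsInClosedCone`); a point set `P ⊆ K` is a *pyramid in `K`* if it is downward closed in `K` for
the coordinatewise order (`IsPyramid`). The *coordinate sum* of a composition `λ ∈ ℕ^{[0,r]}` is
`B(λ) = Σ i·λ_i` (`coordSumList`), of a point set `B(P) = Σ (x + y + z)` (`coordSumSet`);
`ξ̄(i)` / `ξ(i)` count the points of `C̄` / `C` with coordinate sum `i`, `ῑ(n) = min{ι : Σ_{i ≤ ι}
ξ̄(i) ≥ n}`, `β̄(n) = Σ_{i=1}^{n} ῑ(i)` and likewise `ι`, `β` (`xiBar`, `xi`, `iotaBar`, `iota`,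
`betaBar`, `beta`; §5, before Lemma 2). The grid is `G_r = {x + y + z = r}` (§6).

**Problems** (§6, Problems 5, 7, 10), as languages over `{0,1}`. A composition
`λ ∈ ℕ^{[0,r]}` is the list `[λ_0, …, λ_r]` (so `r + 1 = length`), read as the finitely supported
function `listFn λ` (`i ↦ λ_i`, `0` beyond `r`); it is encoded in UNARY with the tree's list
coding `unaryEncodingNat.listBool` (FI §3: "the inputs can be encoded in binary or in unary ...
The hardness results still hold for the unary encoding"; for these problems the input length is
`≥ r` in either encoding), triples with `Encoding.pairBool`, languages by `Encoding.toLanguage`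
(the pattern of `KarpProblems.lean`).
* `TWODXRAY` (Problem 5, 2D-X-RAY): `(μ, ν, ρ)`, three lists of a common length `r + 1`; YES iff
  some `P ⊆ G_r` has `X`-, `Y`-, `Z`-marginals `μ, ν, ρ`.
* `SYMTWODXRAY` / `SKEWSYMTWODXRAY` (Problem 7): `λ` of length `r + 1`; YES iff some
  `P ⊆ G_r ∩ C̄` (resp. `G_r ∩ C`) has `S(P) = λ`.
* `PROMISESYMTHREEDXRAY` / `PROMISESKEWSYMTHREEDXRAY` (Problem 10, a PROMISE problem, rendered as
  the language "promise ∧ yes"): `λ` with `|λ| = 3n` and `B(λ) = β̄(n)` (resp. `β(n)`) such that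
  some finite `P ⊆ C̄` (resp. `C`) has `S(P) = λ`. Instances violating the promise are
  non-members; since the promise is decidable in polynomial time (prefix sums of `ξ̄`), a Karp
  reduction FROM the language must and can test it (see the docstring of Lemma 4 in the
  assembly file).

**Named facts** (D-0014).
* `GardnerGritzmannPrangenberg1999_twoDXRay_NPHard : IsNPHard TWODXRAY` — GGP 1999, Thm. 3.7:
  "For `m ≥ 3`, CONSISTENCY_{F^d}(S_1, …, S_m) is NP-complete in the strong sense" (`d ≥ 2`,
  any `m` different lattice lines), here `d = 2` and the three lines spanned by `(1,0)`, `(0,1)`,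
  `(1,-1)` (the `X`-, `Y`-, `Z`-marginals of FI's trilinear coordinates on `G_r`), in FI's
  windowed unary form Problem 5 ("2D-X-RAY has been identified as NP-hard (even NP-complete)
  before by [GGP 1999]", FI §6).
* `FischerIkenmeyer2020_lemma8 : TWODXRAY ≤ₚ SYMTWODXRAY ∧ TWODXRAY ≤ₚ SKEWSYMTWODXRAY` —
  Lemma 8 (`r := 13 r'`, `λ := (ρ', 0^{2r'-1}, ν', 0^{5r'-1}, μ', 0^{3r'})`,
  `γ(x, y, z) = (x + 9r', y + 3r', z)`; in the printed surjectivity argument read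
  `M := [9r', 10r']` for `[8r', 9r']`).
* `FischerIkenmeyer2020_lemma5 : SYMTWODXRAY ≤ₚ PROMISESYMTHREEDXRAY ∧ SKEWSYMTWODXRAY ≤ₚ
  PROMISESKEWSYMTHREEDXRAY` — Lemma 5 (with Lemmas 6, 7: `λ := S(P̄_{r-1}) + λ̂`).
The printed reductions are parsimonious; only their decision form (Karp reductions, the tree's
`PolyTimeKarpReducible`) is vendored. The elementary combinatorics (Lemmas 2, 3, 6, 7, Prop. 2)
is not stated here: it is to be PROVED in the sibling proofs file when the reductions are
discharged.

## References

* [FischerIkenmeyer2020] N. Fischer, C. Ikenmeyer, *The computational complexity of plethysm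
  coefficients*, Comput. Complexity 29 (2020) 8, arXiv:2002.00788 (held), §3, §5 (Def. 1,
  Thm. 4, Lemma 2, Prop. 2), §6 (Problems 5–10, Lemmas 3–8, Fig. 2).
* [GardnerGritzmannPrangenberg1999] R. J. Gardner, P. Gritzmann, D. Prangenberg, *On the
  computational complexity of reconstructing lattice sets from their X-rays*, Discrete Math. 202
  (1999) 45–71 (held), §2 (CONSISTENCY), Lemma 3.3, Thm. 3.7, Cor. 3.8.
* [AroraBarak2009] S. Arora, B. Barak, *Computational Complexity*, CUP 2009, §0.1, Def. 2.7.
-/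

namespace Literature.Computability.Complexity

open _root_.Computability
open scoped Notation

namespace Tomography

/-! ### Points, marginals, cones, pyramids (FI 2020, §5–§6) -/

/-- A lattice point `(x, y, z) ∈ ℕ³`. [cite: FischerIkenmeyer2020, §5] -/
abbrev Point : Type := ℕ × ℕ × ℕ

/-- The coordinate sum `x + y + z` of a point (so `G_r = {coordSum = r}`).
[cite: FischerIkenmeyer2020, §5 (B(P)) and §6 (G_r)] -/
def coordSum (p : Point) : ℕ := p.1 + p.2.1 + p.2.2

/-- The `X`-marginal `X_i(P)`: the number of points of `P` with `x`-coordinate `i`.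
[cite: FischerIkenmeyer2020, §6 (marginals)] -/
def xMarginal (P : Finset Point) (i : ℕ) : ℕ := (P.filter fun p => p.1 = i).card

/-- The `Y`-marginal `Y_i(P)`. [cite: FischerIkenmeyer2020, §6 (marginals)] -/
def yMarginal (P : Finset Point) (i : ℕ) : ℕ := (P.filter fun p => p.2.1 = i).card

/-- The `Z`-marginal `Z_i(P)`. [cite: FischerIkenmeyer2020, §6 (marginals)] -/
def zMarginal (P : Finset Point) (i : ℕ) : ℕ := (P.filter fun p => p.2.2 = i).card

/-- The sum-marginal `S_i(P) = Σ_{(x,y,z) ∈ P} (δ_{x,i} + δ_{y,i} + δ_{z,i}) = X_i + Y_i + Z_i`.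
[cite: FischerIkenmeyer2020, §5 eq. (7) and §6 ("S(P) = X(P)+Y(P)+Z(P)")] -/
def sumMarginal (P : Finset Point) (i : ℕ) : ℕ := xMarginal P i + yMarginal P i + zMarginal P i

/-- The open cone `C = {(x, y, z) : x > y > z}`. [cite: FischerIkenmeyer2020, §5] -/
def IsInOpenCone (p : Point) : Prop := p.2.1 < p.1 ∧ p.2.2 < p.2.1

/-- The closed cone `C̄ = {(x, y, z) : x ≥ y ≥ z}`. [cite: FischerIkenmeyer2020, §5] -/
def IsInClosedCone (p : Point) : Prop := p.2.1 ≤ p.1 ∧ p.2.2 ≤ p.2.1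

/-- Membership in the open cone is decidable (two comparisons). [folklore] -/
instance : DecidablePred IsInOpenCone := fun _ => inferInstanceAs (Decidable (_ ∧ _))

/-- Membership in the closed cone is decidable (two comparisons). [folklore] -/
instance : DecidablePred IsInClosedCone := fun _ => inferInstanceAs (Decidable (_ ∧ _))

/-- The coordinatewise order `(x', y', z') ≤ (x, y, z)`. [cite: FischerIkenmeyer2020, §5 (pyramids)] -/
def Below (q p : Point) : Prop := q.1 ≤ p.1 ∧ q.2.1 ≤ p.2.1 ∧ q.2.2 ≤ p.2.2

/-- The coordinatewise order is decidable. [folklore] -/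
instance : DecidableRel Below := fun _ _ => inferInstanceAs (Decidable (_ ∧ _ ∧ _))

/-- The finite set of points below `p`. [folklore] -/
def belowSet (p : Point) : Finset Point :=
  Finset.range (p.1 + 1) ×ˢ Finset.range (p.2.1 + 1) ×ˢ Finset.range (p.2.2 + 1)

/-- `belowSet p` lists exactly the points below `p`. [folklore] -/
@[simp] theorem mem_belowSet {p q : Point} : q ∈ belowSet p ↔ Below q p := by
  simp [belowSet, Below, Finset.mem_product]

/-- `P` is a *pyramid in `K`* (`K` = the open or the closed cone): `P ⊆ K` and `P` is downward
closed in `K` for the coordinatewise order. [cite: FischerIkenmeyer2020, §5 (pyramid in the open / closed cone)] -/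
def IsPyramid (K : Point → Prop) (P : Finset Point) : Prop :=
  (∀ p ∈ P, K p) ∧ ∀ p ∈ P, ∀ q, K q → Below q p → q ∈ P

/-- `IsPyramid` with the inner quantifier bounded by `belowSet` (for decidability). [folklore] -/
theorem isPyramid_iff_bounded (K : Point → Prop) (P : Finset Point) :
    IsPyramid K P ↔ (∀ p ∈ P, K p) ∧ ∀ p ∈ P, ∀ q ∈ belowSet p, K q → q ∈ P := by
  refine and_congr_right fun _ => forall₂_congr fun p _ => ?_
  exact ⟨fun h q hq hK => h q hK (mem_belowSet.1 hq), fun h q hK hb => h q (mem_belowSet.2 hb) hK⟩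

/-- Being a pyramid in a decidable region is decidable (bounded form). [folklore] -/
instance (K : Point → Prop) [DecidablePred K] (P : Finset Point) : Decidable (IsPyramid K P) :=
  decidable_of_iff _ (isPyramid_iff_bounded K P).symm

/-- A composition `λ = [λ_0, …, λ_r] ∈ ℕ^{[0,r]}` as a finitely supported function (`0` beyond
`r`; "treated as finite by omitting trailing zeros"). [cite: FischerIkenmeyer2020, §2 and §6] -/
def listFn (l : List ℕ) (i : ℕ) : ℕ := l.getD i 0

/-- The coordinate sum `B(λ) = Σ_{i=0}^{r} i · λ_i` of a composition. [cite: FischerIkenmeyer2020, §5 (before Lemma 2)] -/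
def coordSumList (l : List ℕ) : ℕ := ∑ i ∈ Finset.range l.length, i * listFn l i

/-- The coordinate sum `B(P) = Σ_{(x,y,z) ∈ P} (x + y + z)` of a point set (`= B(S(P))`).
[cite: FischerIkenmeyer2020, §5 (before Lemma 2)] -/
def coordSumSet (P : Finset Point) : ℕ := ∑ p ∈ P, coordSum p

/-- The finite box `[0, L)³` (every point set with marginals supported below `L` lies in it).
[folklore] -/
def box (L : ℕ) : Finset Point := Finset.range L ×ˢ Finset.range L ×ˢ Finset.range L

/-- `ξ̄(i)`: the number of points of the closed cone with coordinate sum `i` (partitions of `i`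
with at most three parts, OEIS A001399). [cite: FischerIkenmeyer2020, §5 (before Lemma 2)] -/
def xiBar (i : ℕ) : ℕ := ((box (i + 1)).filter fun p => IsInClosedCone p ∧ coordSum p = i).card

/-- `ξ(i)`: the number of points of the open cone with coordinate sum `i` (OEIS A069905).
[cite: FischerIkenmeyer2020, §5 (before Lemma 2)] -/
def xi (i : ℕ) : ℕ := ((box (i + 1)).filter fun p => IsInOpenCone p ∧ coordSum p = i).card

/-- `ῑ(n) = min {ι : Σ_{i=0}^{ι} ξ̄(i) ≥ n}` (the set is nonempty: `ξ̄(i) ≥ 1`).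
[cite: FischerIkenmeyer2020, §5 (before Lemma 2)] -/
noncomputable def iotaBar (n : ℕ) : ℕ := sInf {ι | n ≤ ∑ i ∈ Finset.range (ι + 1), xiBar i}

/-- `ι(n) = min {ι : Σ_{i=0}^{ι} ξ(i) ≥ n}` (nonempty: `ξ(i) ≥ 1` for `i ≥ 3`).
[cite: FischerIkenmeyer2020, §5 (before Lemma 2)] -/
noncomputable def iota (n : ℕ) : ℕ := sInf {ι | n ≤ ∑ i ∈ Finset.range (ι + 1), xi i}

/-- `β̄(n) = Σ_{i=1}^{n} ῑ(i)`: the least coordinate sum of an `n`-point set in the closed cone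
(Lemma 2). [cite: FischerIkenmeyer2020, §5 (before Lemma 2)] -/
noncomputable def betaBar (n : ℕ) : ℕ := ∑ i ∈ Finset.Icc 1 n, iotaBar i

/-- `β(n) = Σ_{i=1}^{n} ι(i)`: the least coordinate sum of an `n`-point set in the open cone
(Lemma 2). [cite: FischerIkenmeyer2020, §5 (before Lemma 2)] -/
noncomputable def beta (n : ℕ) : ℕ := ∑ i ∈ Finset.Icc 1 n, iota i

/-- The complete pyramid `P̄_r = {x + y + z ≤ r} ∩ C̄` in the closed cone.
[cite: FischerIkenmeyer2020, §6 (before Lemma 6)] -/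
def completePyramidBar (r : ℕ) : Finset Point :=
  (box (r + 1)).filter fun p => IsInClosedCone p ∧ coordSum p ≤ r

/-- The complete pyramid `P_r = {x + y + z ≤ r} ∩ C` in the open cone.
[cite: FischerIkenmeyer2020, §6 (before Lemma 6)] -/
def completePyramid (r : ℕ) : Finset Point :=
  (box (r + 1)).filter fun p => IsInOpenCone p ∧ coordSum p ≤ r

/-- The point sets in `K` with sum-marginal `λ`, as a finset: all of them lie in the box
`[0, |λ|)³` with `|λ|` the length of the list (`pointSets_complete`).
[cite: FischerIkenmeyer2020, §5 (Def. 1)] -/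
def pointSets (K : Point → Prop) [DecidablePred K] (l : List ℕ) : Finset (Finset Point) :=
  (box l.length).powerset.filter fun P =>
    (∀ p ∈ P, K p) ∧ ∀ i ∈ Finset.range l.length, sumMarginal P i = listFn l i

/-- The pyramids in `K` with sum-marginal `λ`. [cite: FischerIkenmeyer2020, §5 (Def. 1)] -/
def pyramids (K : Point → Prop) [DecidablePred K] (l : List ℕ) : Finset (Finset Point) :=
  (pointSets K l).filter fun P => IsPyramid K P

/-! ### Basic API -/

/-- `listFn` inside the list. [folklore] -/
theorem listFn_of_lt {l : List ℕ} {i : ℕ} (h : i < l.length) : listFn l i = l[i] := by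
  simp [listFn, List.getElem?_eq_getElem h]

/-- `listFn` vanishes beyond the list. [folklore] -/
theorem listFn_of_le {l : List ℕ} {i : ℕ} (h : l.length ≤ i) : listFn l i = 0 := by
  simp [listFn, List.getElem?_eq_none h]

/-- A point of `P` with `x`-coordinate `i` makes `S_i(P)` positive. [folklore] -/
theorem sumMarginal_pos_of_fst {P : Finset Point} {p : Point} (hp : p ∈ P) :
    0 < sumMarginal P p.1 := by
  have : 0 < xMarginal P p.1 := Finset.card_pos.2 ⟨p, Finset.mem_filter.2 ⟨hp, rfl⟩⟩
  unfold sumMarginal; omega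

/-- A point of `P` with `y`-coordinate `i` makes `S_i(P)` positive. [folklore] -/
theorem sumMarginal_pos_of_snd {P : Finset Point} {p : Point} (hp : p ∈ P) :
    0 < sumMarginal P p.2.1 := by
  have : 0 < yMarginal P p.2.1 := Finset.card_pos.2 ⟨p, Finset.mem_filter.2 ⟨hp, rfl⟩⟩
  unfold sumMarginal; omega

/-- A point of `P` with `z`-coordinate `i` makes `S_i(P)` positive. [folklore] -/
theorem sumMarginal_pos_of_thd {P : Finset Point} {p : Point} (hp : p ∈ P) :
    0 < sumMarginal P p.2.2 := by
  have : 0 < zMarginal P p.2.2 := Finset.card_pos.2 ⟨p, Finset.mem_filter.2 ⟨hp, rfl⟩⟩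
  unfold sumMarginal; omega

/-- Membership in the box. [folklore] -/
@[simp] theorem mem_box {L : ℕ} {p : Point} : p ∈ box L ↔ p.1 < L ∧ p.2.1 < L ∧ p.2.2 < L := by
  simp [box, Finset.mem_product]

/-- A point set with sum-marginal `λ` lies in the box `[0, |λ|)³`. [folklore] -/
theorem subset_box_of_sumMarginal_eq {P : Finset Point} {l : List ℕ}
    (h : sumMarginal P = listFn l) : P ⊆ box l.length := by
  intro p hp
  have h1 := sumMarginal_pos_of_fst hp
  have h2 := sumMarginal_pos_of_snd hp
  have h3 := sumMarginal_pos_of_thd hp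
  rw [h] at h1 h2 h3
  refine mem_box.2 ⟨?_, ?_, ?_⟩ <;> by_contra hc <;> push Not at hc
  · exact absurd (listFn_of_le hc) h1.ne'
  · exact absurd (listFn_of_le hc) h2.ne'
  · exact absurd (listFn_of_le hc) h3.ne'

/-- The marginals of a point set inside the box `[0, L)³` vanish from `L` on. [folklore] -/
theorem sumMarginal_eq_zero_of_subset_box {P : Finset Point} {L i : ℕ} (hP : P ⊆ box L)
    (hi : L ≤ i) : sumMarginal P i = 0 := by
  have hx : xMarginal P i = 0 := Finset.card_eq_zero.2 (Finset.filter_eq_empty_iff.2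
    fun p hp h => by have := (mem_box.1 (hP hp)).1; omega)
  have hy : yMarginal P i = 0 := Finset.card_eq_zero.2 (Finset.filter_eq_empty_iff.2
    fun p hp h => by have := (mem_box.1 (hP hp)).2.1; omega)
  have hz : zMarginal P i = 0 := Finset.card_eq_zero.2 (Finset.filter_eq_empty_iff.2
    fun p hp h => by have := (mem_box.1 (hP hp)).2.2; omega)
  simp [sumMarginal, hx, hy, hz]

/-- **`pointSets` is complete**: a finite point set is listed in `pointSets K λ` iff it lies in `K`
and has sum-marginal `λ`. [cite: FischerIkenmeyer2020, §5 (Def. 1)] -/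
theorem mem_pointSets_iff {K : Point → Prop} [DecidablePred K] {l : List ℕ} {P : Finset Point} :
    P ∈ pointSets K l ↔ (∀ p ∈ P, K p) ∧ sumMarginal P = listFn l := by
  rw [pointSets, Finset.mem_filter, Finset.mem_powerset]
  constructor
  · rintro ⟨hP, hK, hS⟩
    refine ⟨hK, funext fun i => ?_⟩
    by_cases hi : i < l.length
    · exact hS i (Finset.mem_range.2 hi)
    · push Not at hi
      rw [sumMarginal_eq_zero_of_subset_box hP hi, listFn_of_le hi]
  · rintro ⟨hK, hS⟩
    exact ⟨subset_box_of_sumMarginal_eq hS, hK, fun i _ => by rw [hS]⟩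

/-- Membership in `pyramids`. [cite: FischerIkenmeyer2020, §5 (Def. 1)] -/
theorem mem_pyramids_iff {K : Point → Prop} [DecidablePred K] {l : List ℕ} {P : Finset Point} :
    P ∈ pyramids K l ↔ IsPyramid K P ∧ sumMarginal P = listFn l := by
  rw [pyramids, Finset.mem_filter, mem_pointSets_iff]
  exact ⟨fun h => ⟨h.2, h.1.2⟩, fun h => ⟨⟨h.1.1, h.2⟩, h.1⟩⟩

/-- The set defining `ῑ(n)` is nonempty: `Σ_{i ≤ n} ξ̄(i) ≥ n` because `(i, 0, 0) ∈ C̄` gives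
`ξ̄(i) ≥ 1`. [folklore] -/
theorem le_sum_xiBar (n : ℕ) : n ≤ ∑ i ∈ Finset.range (n + 1), xiBar i := by
  have h1 : ∀ i, 1 ≤ xiBar i := fun i =>
    Finset.card_pos.2 ⟨(i, 0, 0), Finset.mem_filter.2 ⟨mem_box.2 ⟨by simp, by simp, by simp⟩,
      ⟨by simp [IsInClosedCone], by simp [coordSum]⟩⟩⟩
  calc n ≤ n + 1 := Nat.le_succ n
    _ = ∑ _i ∈ Finset.range (n + 1), 1 := by simp
    _ ≤ ∑ i ∈ Finset.range (n + 1), xiBar i := Finset.sum_le_sum fun i _ => h1 i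

/-- The set defining `ι(n)` is nonempty: `Σ_{i ≤ n+2} ξ(i) ≥ n` because `(i+2, 1, 0) ∈ C` gives
`ξ(i + 3) ≥ 1`. [folklore] -/
theorem le_sum_xi (n : ℕ) : n ≤ ∑ i ∈ Finset.range (3 + n), xi i := by
  have h1 : ∀ i, 1 ≤ xi (3 + i) := fun i =>
    Finset.card_pos.2 ⟨(i + 2, 1, 0), Finset.mem_filter.2 ⟨mem_box.2 ⟨by simp; omega, by simp, by simp⟩,
      ⟨by simp [IsInOpenCone], by simp [coordSum]; omega⟩⟩⟩
  calc n = ∑ _i ∈ Finset.range n, 1 := by simp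
    _ ≤ ∑ i ∈ Finset.range n, xi (3 + i) := Finset.sum_le_sum fun i _ => h1 i
    _ ≤ ∑ i ∈ Finset.range 3, xi i + ∑ i ∈ Finset.range n, xi (3 + i) := Nat.le_add_left _ _
    _ = ∑ i ∈ Finset.range (3 + n), xi i := (Finset.sum_range_add xi 3 n).symm

/-- `ῑ(n)` attains the defining inequality. [cite: FischerIkenmeyer2020, §5 (before Lemma 2)] -/
theorem le_sum_xiBar_iotaBar (n : ℕ) : n ≤ ∑ i ∈ Finset.range (iotaBar n + 1), xiBar i :=
  Nat.sInf_mem (s := {ι | n ≤ ∑ i ∈ Finset.range (ι + 1), xiBar i}) ⟨n, le_sum_xiBar n⟩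

/-- `ι(n)` attains the defining inequality. [cite: FischerIkenmeyer2020, §5 (before Lemma 2)] -/
theorem le_sum_xi_iota (n : ℕ) : n ≤ ∑ i ∈ Finset.range (iota n + 1), xi i :=
  Nat.sInf_mem (s := {ι | n ≤ ∑ i ∈ Finset.range (ι + 1), xi i})
    ⟨2 + n, by
      change n ≤ ∑ i ∈ Finset.range (2 + n + 1), xi i
      rw [show 2 + n + 1 = 3 + n by omega]; exact le_sum_xi n⟩

/-- Minimality of `ῑ(n)`. [cite: FischerIkenmeyer2020, §5 (before Lemma 2)] -/
theorem iotaBar_le {n ι : ℕ} (h : n ≤ ∑ i ∈ Finset.range (ι + 1), xiBar i) : iotaBar n ≤ ι :=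
  Nat.sInf_le h

/-- Minimality of `ι(n)`. [cite: FischerIkenmeyer2020, §5 (before Lemma 2)] -/
theorem iota_le {n ι : ℕ} (h : n ≤ ∑ i ∈ Finset.range (ι + 1), xi i) : iota n ≤ ι :=
  Nat.sInf_le h

/-! ### The problems (FI 2020, §6) -/

/-- Yes-instances of **2D-X-RAY** (Problem 5): `(μ, ν, ρ) ∈ (ℕ^{[0,r]})³` (three lists of the
same length `r + 1`) such that some point set `P ⊆ G_r = {x + y + z = r}` has `X`-, `Y`- and
`Z`-marginals `μ`, `ν`, `ρ`. [cite: FischerIkenmeyer2020, §6 (Problem 5)] -/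
def twoDXRaySet : Set (List ℕ × List ℕ × List ℕ) :=
  {I | ∃ r : ℕ, I.1.length = r + 1 ∧ I.2.1.length = r + 1 ∧ I.2.2.length = r + 1 ∧
    ∃ P : Finset Point, (∀ p ∈ P, coordSum p = r) ∧
      xMarginal P = listFn I.1 ∧ yMarginal P = listFn I.2.1 ∧ zMarginal P = listFn I.2.2}

/-- The unary Boolean encoding of a composition `λ ∈ ℕ^{[0,r]}`: the tree's list coding of the
unary numerals `1^{λ_i}` (Mathlib `unaryEncodingNat`). [cite: FischerIkenmeyer2020, §3 ("encoded in binary or in unary")] -/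
abbrev encodingComposition : Encoding (List ℕ) Bool := unaryEncodingNat.listBool

/-- **2D-X-RAY** as a language over `{0,1}` (instances `⟨μ, ⟨ν, ρ⟩⟩`).
[cite: FischerIkenmeyer2020, §6 (Problem 5)] -/
def TWODXRAY : Language Bool :=
  (encodingComposition.pairBool (encodingComposition.pairBool encodingComposition)).toLanguage
    twoDXRaySet

/-- Yes-instances of **SYMMETRIC-2D-X-RAY** (Problem 7): `λ ∈ ℕ^{[0,r]}` such that some
`P ⊆ G_r ∩ C̄` has sum-marginal `S(P) = λ`. [cite: FischerIkenmeyer2020, §6 (Problem 7)] -/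
def symTwoDXRaySet : Set (List ℕ) :=
  {l | ∃ r : ℕ, l.length = r + 1 ∧ ∃ P : Finset Point,
    (∀ p ∈ P, IsInClosedCone p ∧ coordSum p = r) ∧ sumMarginal P = listFn l}

/-- Yes-instances of **SKEW-SYMMETRIC-2D-X-RAY** (Problem 7): `λ ∈ ℕ^{[0,r]}` such that some
`P ⊆ G_r ∩ C` has `S(P) = λ`. [cite: FischerIkenmeyer2020, §6 (Problem 7)] -/
def skewSymTwoDXRaySet : Set (List ℕ) :=
  {l | ∃ r : ℕ, l.length = r + 1 ∧ ∃ P : Finset Point,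
    (∀ p ∈ P, IsInOpenCone p ∧ coordSum p = r) ∧ sumMarginal P = listFn l}

/-- **SYMMETRIC-2D-X-RAY** as a language. [cite: FischerIkenmeyer2020, §6 (Problem 7)] -/
def SYMTWODXRAY : Language Bool := encodingComposition.toLanguage symTwoDXRaySet

/-- **SKEW-SYMMETRIC-2D-X-RAY** as a language. [cite: FischerIkenmeyer2020, §6 (Problem 7)] -/
def SKEWSYMTWODXRAY : Language Bool := encodingComposition.toLanguage skewSymTwoDXRaySet

/-- The promise of **PROMISE-SYMMETRIC-3D-X-RAY**: `|λ| = 3n` and `B(λ) = β̄(n)`.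
[cite: FischerIkenmeyer2020, §6 (Problem 10)] -/
def SymPromise (l : List ℕ) : Prop := ∃ n : ℕ, l.sum = 3 * n ∧ coordSumList l = betaBar n

/-- The promise of **PROMISE-SKEW-SYMMETRIC-3D-X-RAY**: `|λ| = 3n` and `B(λ) = β(n)`.
[cite: FischerIkenmeyer2020, §6 (Problem 10)] -/
def SkewSymPromise (l : List ℕ) : Prop := ∃ n : ℕ, l.sum = 3 * n ∧ coordSumList l = beta n

/-- Yes-instances of **PROMISE-SYMMETRIC-3D-X-RAY** (Problem 10) satisfying the promise:
`λ` with `|λ| = 3n`, `B(λ) = β̄(n)`, and some finite `P ⊆ C̄` with `S(P) = λ`.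
[cite: FischerIkenmeyer2020, §6 (Problem 10)] -/
def promiseSymThreeDXRaySet : Set (List ℕ) :=
  {l | SymPromise l ∧ ∃ P : Finset Point, (∀ p ∈ P, IsInClosedCone p) ∧ sumMarginal P = listFn l}

/-- Yes-instances of **PROMISE-SKEW-SYMMETRIC-3D-X-RAY** (Problem 10) satisfying the promise:
`λ` with `|λ| = 3n`, `B(λ) = β(n)`, and some finite `P ⊆ C` with `S(P) = λ`.
[cite: FischerIkenmeyer2020, §6 (Problem 10)] -/
def promiseSkewSymThreeDXRaySet : Set (List ℕ) :=
  {l | SkewSymPromise l ∧ ∃ P : Finset Point, (∀ p ∈ P, IsInOpenCone p) ∧ sumMarginal P = listFn l}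

/-- **PROMISE-SYMMETRIC-3D-X-RAY** as a language ("promise ∧ yes").
[cite: FischerIkenmeyer2020, §6 (Problem 10)] -/
def PROMISESYMTHREEDXRAY : Language Bool := encodingComposition.toLanguage promiseSymThreeDXRaySet

/-- **PROMISE-SKEW-SYMMETRIC-3D-X-RAY** as a language ("promise ∧ yes").
[cite: FischerIkenmeyer2020, §6 (Problem 10)] -/
def PROMISESKEWSYMTHREEDXRAY : Language Bool :=
  encodingComposition.toLanguage promiseSkewSymThreeDXRaySet

/-- The point sets solving a (SKEW-)SYMMETRIC instance are exactly the members of `pointSets`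
(so the existential quantifiers above range over a computable finite set).
[cite: FischerIkenmeyer2020, §5 (Def. 1) and §6 (Problem 10)] -/
theorem mem_promiseSymThreeDXRaySet_iff (l : List ℕ) :
    l ∈ promiseSymThreeDXRaySet ↔ SymPromise l ∧ (pointSets IsInClosedCone l).Nonempty := by
  simp only [promiseSymThreeDXRaySet, Set.mem_setOf_eq, Finset.Nonempty, mem_pointSets_iff]

/-- Skew version of `mem_promiseSymThreeDXRaySet_iff`. [cite: FischerIkenmeyer2020, §6 (Problem 10)] -/
theorem mem_promiseSkewSymThreeDXRaySet_iff (l : List ℕ) :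
    l ∈ promiseSkewSymThreeDXRaySet ↔
      SkewSymPromise l ∧ (pointSets IsInOpenCone l).Nonempty := by
  simp only [promiseSkewSymThreeDXRaySet, Set.mem_setOf_eq, Finset.Nonempty, mem_pointSets_iff]

/-! ### The printed hardness and reduction results as named facts (D-0014) -/

/-- **Gardner–Gritzmann–Prangenberg 1999, Thm. 3.7** ("For `m ≥ 3`,
CONSISTENCY_{F^d}(S_1, …, S_m) is NP-complete in the strong sense"; `d ≥ 2`, `S_1, …, S_m`
different lattice lines fixed beforehand; NP-hardness by reduction from 1-IN-3-SAT, §3), in the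
instance `d = 2`, `m = 3`, lines spanned by `(1,0)`, `(0,1)`, `(1,-1)` — i.e. prescribed `X`-,
`Y`-, `Z`-marginals of a lattice set in trilinear coordinates `x + y + z = r` — and in the
windowed, unary form **2D-X-RAY** of Fischer–Ikenmeyer 2020, Problem 5 ("2D-X-RAY has been
identified as NP-hard (even NP-complete) before by Gardner, Gritzmann and Prangenberg"), for the
tree's Karp notion `IsNPHard` (strong NP-hardness covers the unary encoding; a GGP instance, given
by X-sets, is translated into the window `[0, r]²` containing its grid).
[cite: GardnerGritzmannPrangenberg1999, Thm. 3.7] [cite: FischerIkenmeyer2020, §6 (Problem 5)] -/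
def GardnerGritzmannPrangenberg1999_twoDXRay_NPHard : Prop :=
  IsNPHard TWODXRAY

/-- **Fischer–Ikenmeyer 2020, Lemma 8** ("There exist parsimonious polynomial-time reductions
from 2D-X-RAY to SYMMETRIC-2D-X-RAY and to SKEW-SYMMETRIC-2D-X-RAY"), decision form: with
`r := 13 r'`, an instance `(μ', ν', ρ') ∈ (ℕ^{[0,r']})³` goes to
`λ := (ρ'_0, …, ρ'_{r'}, 0^{2r'-1}, ν'_0, …, ν'_{r'}, 0^{5r'-1}, μ'_0, …, μ'_{r'}, 0^{3r'}) ∈ ℕ^{[0,r]}`,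
and `γ(x, y, z) = (x + 9r', y + 3r', z)` is a bijection from the solutions of the former onto
those of the latter (both cones). [cite: FischerIkenmeyer2020, Lemma 8] -/
def FischerIkenmeyer2020_lemma8 : Prop :=
  TWODXRAY ≤ₚ SYMTWODXRAY ∧ TWODXRAY ≤ₚ SKEWSYMTWODXRAY

/-- **Fischer–Ikenmeyer 2020, Lemma 5** ("There exists a parsimonious polynomial-time reduction
from SYMMETRIC-2D-X-RAY to PROMISE-SYMMETRIC-3D-X-RAY. Moreover, … from SKEW-SYMMETRIC-2D-X-RAY
to PROMISE-SKEW-SYMMETRIC-3D-X-RAY"), decision form: `λ̂ ∈ ℕ^{[0,r]}` with `|λ̂| = 3n` and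
`B(λ̂) = r n` goes to `λ := S(P̄_{r-1}) + λ̂` (Lemma 7; `P_{r-1}` in the open cone), every other
instance to a trivial no-instance; correctness is Lemma 6 (`B(P) = β̄(|P|)` iff
`P̄_{r-1} ⊆ P ⊆ P̄_r` for some `r`). [cite: FischerIkenmeyer2020, Lemma 5] -/
def FischerIkenmeyer2020_lemma5 : Prop :=
  SYMTWODXRAY ≤ₚ PROMISESYMTHREEDXRAY ∧ SKEWSYMTWODXRAY ≤ₚ PROMISESKEWSYMTHREEDXRAY

end Tomography

end Literature.Computability.Complexity
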